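import Summits.ResolutionOfSingularities.ResolutionOfSingularities.Theorems.FrobeniusLadderFInjectiveMacaulayficationFullCentreDescentRegular
import HarnessLib

/-!
# CENTRE DESCENT, RECIPE-FREE FORM — towers WITH MEMORY (crux `FInjectiveMacaulayfication` stmt-ResolutionOfSingularities-15315, chain w45a; res-L1-w45a-lead-1 g9;
# continues `…FullCentreDescentRegular` §1 `exists_centre_of_tower`)

[OURS · L1 W4.5a] Support file (`--supports stmt-ResolutionOfSingularities-15315 --as helper`); NOT a statement of any manuscript; def-free, fact-free, UNCONDITIONAL; generic.
AI-written (AI review is weaker than expert review).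

WHY. The two typed tower programmes («TT» p632743, «RR» p634003) use MEMORYLESS recipes `c : ∀ p S, S.IdealSheafData` — the centre of a floor depends on the floor alone. Our
own computations now show what the classical theory predicts for memoryless recipes (Kollár 2007, §3.6: «the resolution process has to have some memory»): the N_red recipe is
an escalator (R19.7) and the rad-τ recipe has an abstract period-two cycle (res-L1-w45a-idea-1 FB5-r7, res-L1-w45a-tri-2 replay). A process WITH MEMORY (centres depending on the
exceptional configuration created so far, on a boundary, on an invariant's history, …) is NOT a `CentreRecipe`; but the kernel bridge never used the recipe — only that at each
floor SOME centre is blown up whose support lies inside every closed set off which the floor is «good», and that every blowing up along it continues the tower. This file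
re-proves lead-1's generic Lemma A in that RECIPE-FREE form, so that ANY deterministic or non-deterministic process — with memory encoded inside the tower predicate `T` (e.g.
`T n S := ∃ m : Memory S, Proc n S m`) — inherits the bridge «tower terminates ⇒ ONE fibre-supported centre» verbatim:
* §1 ★ `exists_centre_of_tower_free (Q R) (hQ hR) (T) (h0) (hstep)` with
  `hstep : ∀ n S [IsNoetherian S] [IsIntegral S], T (n+1) S → ∃ J : S.IdealSheafData, (∀ F, IsClosed F → (∀ s ∉ F, R S s) → supp J ⊆ F) ∧ ∀ S₁ g, IsBlowup g J → T n S₁`;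
  instances `exists_fullCentre_of_tower_free_of_regularOff` (R := regular, Q := FULL — the F-half's currency) and `exists_regularCentre_of_tower_free` (R = Q := regular — T″'s).
* §2 (remark) `exists_centre_of_tower` (p632502) IS the special case `J := c S` — not re-declared (statement-dedup).
HONEST CAVEATS: pure plumbing; no process is defined or evaluated here; a process with memory still has to be TYPED (its `T`) and its `hstep` PROVED (Sing-support of its centres)
before this lemma says anything; nothing of the crux is proved.
[folklore assembly; cite: Temkin2008, Lemma 2.1.4] [cite: StacksProject, Tag 080B; Tag 02OS] [cite: Kollar2007, Claim 3.6.3]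
-/

-- single-problem summit: the doubled namespace component is forced
set_option linter.dupNamespace false

noncomputable section

open AlgebraicGeometry CategoryTheory CategoryTheory.Limits Literature.AlgebraicGeometry.Resolution TopologicalSpace IsLocalRing

namespace Summit.ResolutionOfSingularities.ResolutionOfSingularities.Theorems.FInjectiveMacaulayfication.FullCentreDescent

open Summit.ResolutionOfSingularities.ResolutionOfSingularities.Theorems.FInjectiveMacaulayfication
open SliceableCentre

/-! ## §1 The recipe-free descent -/

/-- **GENERIC LEMMA A, RECIPE-FREE (towers with memory).** `R`, `Q` stalk-local point properties descending along isomorphic stalk maps; `T : ℕ → Scheme → Prop` ANY tower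
predicate with `T 0 S ⇒ Q` at every point (`h0`) and, at every Noetherian integral floor, `T (n+1) S ⇒` SOME centre `J`, supported inside every closed `F` off which `S` is `R`,
ALL of whose blowing ups satisfy `T n` (`hstep`). Then `T n S` on a Noetherian integral `S` that is `R` off a closed `F` missing a point yields ONE centre `𝓚 ≠ ⊥`, `supp 𝓚 ⊆ F`,
all of whose blowing ups are `Q` at every point. Same induction as `exists_centre_of_tower` (floor zero `exists_centre_of_forall`; `J ≠ ⊥` from the missing point; `exists_isBlowup`;
transports `exists_not_mem_preimage_of_isBlowup` / `of_not_mem_preimage_of_isBlowup`; descent `exists_centre_of_isBlowup`). [folklore assembly; OURS] [cite: Temkin2008, Lemma 2.1.4]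
[cite: StacksProject, Tag 080B; Tag 02OS] -/
theorem exists_centre_of_tower_free (Q R : (S : Scheme.{0}) → S → Prop)
    (hQ : ∀ {X Y : Scheme.{0}} (π : X ⟶ Y) (x : X) [IsIso (π.stalkMap x)], Q Y (π.base x) → Q X x)
    (hR : ∀ {X Y : Scheme.{0}} (π : X ⟶ Y) (x : X) [IsIso (π.stalkMap x)], R Y (π.base x) → R X x)
    (T : ℕ → Scheme.{0} → Prop)
    (h0 : ∀ (S : Scheme.{0}), T 0 S → ∀ s : S, Q S s)
    (hstep : ∀ (n : ℕ) (S : Scheme.{0}) [IsNoetherian S] [IsIntegral S], T (n + 1) S →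
      ∃ J : S.IdealSheafData, (∀ F : Set S, IsClosed F → (∀ s : S, s ∉ F → R S s) → (J.support : Set S) ⊆ F) ∧
        ∀ (S₁ : Scheme.{0}) (g : S₁ ⟶ S), IsBlowup g J → T n S₁) :
    ∀ (n : ℕ) (S : Scheme.{0}) [IsNoetherian S] [IsIntegral S] (F : Set S), IsClosed F → (∃ s : S, s ∉ F) →
      (∀ s : S, s ∉ F → R S s) → T n S →
      ∃ 𝓚 : S.IdealSheafData, 𝓚 ≠ ⊥ ∧ (∀ s ∈ (𝓚.support : Set S), s ∈ F) ∧
        ∀ (S'' : Scheme.{0}) (π : S'' ⟶ S), IsBlowup π 𝓚 → ∀ s : S'', Q S'' s := by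
  intro n
  induction n with
  | zero =>
    intro S _ _ F _ hne _ hT
    obtain ⟨s, -⟩ := hne
    haveI : Nonempty S := ⟨s⟩
    exact exists_centre_of_forall Q hQ S F (h0 S hT)
  | succ n ih =>
    intro S _ _ F hF hne hRF hT
    obtain ⟨J, hJ, hJT⟩ := hstep n S hT
    have hJF : (J.support : Set S) ⊆ F := hJ F hF hRF
    have hJne : J ≠ ⊥ := by
      intro h
      obtain ⟨s, hs⟩ := hne
      have h1 : J.support = ⊤ := Scheme.IdealSheafData.support_eq_top_iff.mpr h
      have h2 : s ∈ (J.support : Set S) := by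
        rw [h1]
        exact Set.mem_univ s
      exact hs (hJF h2)
    obtain ⟨S₁, g, hg⟩ := exists_isBlowup S J
    haveI : IsIntegral S₁ := hg.isIntegral hJne
    haveI : IsNoetherian S₁ := isNoetherian_of_isBlowup hg
    obtain h₁ := ih S₁ (g.base ⁻¹' F) (hF.preimage g.continuous) (exists_not_mem_preimage_of_isBlowup hg F hJF hne)
      (fun s₁ hs₁ => of_not_mem_preimage_of_isBlowup R hR hg F hJF hRF s₁ hs₁) (hJT S₁ g hg)
    exact exists_centre_of_isBlowup Q hQ hg F hJF h₁

/-- **RECIPE-FREE LEMMA A, F-half currency** (invariant REGULAR off `F`, conclusion FULL): for ANY tower predicate whose steps blow up Sing-supported centres (`hstep`: a centre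
supported in the closure of the singular locus, all of whose blowing ups continue the tower) and which reads FULL off floor zero. [folklore assembly; OURS] -/
theorem exists_fullCentre_of_tower_free_of_regularOff (p : ℕ) (T : ℕ → Scheme.{0} → Prop)
    (h0 : ∀ (S : Scheme.{0}), T 0 S → ∀ s : S, FullCl p (S.presheaf.stalk s))
    (hstep : ∀ (n : ℕ) (S : Scheme.{0}) [IsNoetherian S] [IsIntegral S], T (n + 1) S →
      ∃ J : S.IdealSheafData, (J.support : Set S) ⊆ closure ((Scheme.regularLocus S)ᶜ) ∧
        ∀ (S₁ : Scheme.{0}) (g : S₁ ⟶ S), IsBlowup g J → T n S₁) :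
    ∀ (n : ℕ) (S : Scheme.{0}) [IsNoetherian S] [IsIntegral S] (F : Set S), IsClosed F → (∃ s : S, s ∉ F) →
      (∀ s : S, s ∉ F → s ∈ Scheme.regularLocus S) → T n S →
      ∃ 𝓚 : S.IdealSheafData, 𝓚 ≠ ⊥ ∧ (∀ s ∈ (𝓚.support : Set S), s ∈ F) ∧
        ∀ (S'' : Scheme.{0}) (π : S'' ⟶ S), IsBlowup π 𝓚 → ∀ s : S'', FullCl p (S''.presheaf.stalk s) :=
  exists_centre_of_tower_free (fun S s => FullCl p (S.presheaf.stalk s)) (fun S s => s ∈ Scheme.regularLocus S)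
    (fun π x _ h => fullCl_descends p π x h) (fun π x _ h => mem_regularLocus_descends π x h) T h0
    (fun n S _ _ hT => by
      obtain ⟨J, hJ, hJT⟩ := hstep n S hT
      exact ⟨J, fun F hF hreg => support_subset_of_subset_closure_compl_regularLocus J hJ F hF hreg, hJT⟩)

/-- **RECIPE-FREE LEMMA A, T-half currency** (invariant and conclusion REGULAR). [folklore assembly; OURS] -/
theorem exists_regularCentre_of_tower_free (T : ℕ → Scheme.{0} → Prop)
    (h0 : ∀ (S : Scheme.{0}), T 0 S → ∀ s : S, s ∈ Scheme.regularLocus S)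
    (hstep : ∀ (n : ℕ) (S : Scheme.{0}) [IsNoetherian S] [IsIntegral S], T (n + 1) S →
      ∃ J : S.IdealSheafData, (J.support : Set S) ⊆ closure ((Scheme.regularLocus S)ᶜ) ∧
        ∀ (S₁ : Scheme.{0}) (g : S₁ ⟶ S), IsBlowup g J → T n S₁) :
    ∀ (n : ℕ) (S : Scheme.{0}) [IsNoetherian S] [IsIntegral S] (F : Set S), IsClosed F → (∃ s : S, s ∉ F) →
      (∀ s : S, s ∉ F → s ∈ Scheme.regularLocus S) → T n S →
      ∃ 𝓚 : S.IdealSheafData, 𝓚 ≠ ⊥ ∧ (∀ s ∈ (𝓚.support : Set S), s ∈ F) ∧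
        ∀ (S'' : Scheme.{0}) (π : S'' ⟶ S), IsBlowup π 𝓚 → ∀ s : S'', s ∈ Scheme.regularLocus S'' :=
  exists_centre_of_tower_free (fun S s => s ∈ Scheme.regularLocus S) (fun S s => s ∈ Scheme.regularLocus S)
    (fun π x _ h => mem_regularLocus_descends π x h) (fun π x _ h => mem_regularLocus_descends π x h) T h0
    (fun n S _ _ hT => by
      obtain ⟨J, hJ, hJT⟩ := hstep n S hT
      exact ⟨J, fun F hF hreg => support_subset_of_subset_closure_compl_regularLocus J hJ F hF hreg, hJT⟩)

/-! ## §2 Consistency (remark, no declaration)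

`exists_centre_of_tower` (p632502, memoryless recipe `c`) is the special case `hstep := fun n S _ _ hT => ⟨c S, hc S, hsucc n S hT⟩` of `exists_centre_of_tower_free` — not
re-declared here (the statements coincide verbatim; the gate's statement-dedup forbids the restatement). -/

end Summit.ResolutionOfSingularities.ResolutionOfSingularities.Theorems.FInjectiveMacaulayfication.FullCentreDescent

end
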